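import Mathlib
import Literature.Computability.AlgebraicComplexity.FSV18OccurTopFanIn
import Literature.RepresentationTheory.AlgebraicGroups.CayleyOmegaProcess
import HarnessLib

/-!
# The top level of [ASSS16] §4 on the FSV occur-`k` formula model: the children of the root `+` gate

Agrawal–Saha–Saptharishi–Saxena, *Jacobian hits circuits* [ASSS16] (arXiv:1111.0582), §4, the start
of the proof of Theorem `thm:dDkrPIT` (locator: paper:arxiv-1111.0582 p0009.txt:L22–L34): "assume
that `C` is a depth-`D` occur-`k` formula of size `s` with a `+` gate on top having top fanin at most
`k`. Let `C(x) = Σ_{i=1}^{k} T_i`. The goal is to construct a `Φ` that is faithful to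
`T = {T_1, …, T_k}` … count level of a gate from the top — the gates `T_i`'s are at level `2`",
and (p0009:L30–L32, via Thm. 2.1) a map faithful to `T` keeps `C = Σ_i T_i` non-zero.

For the val-lit N1 push (bypass of FSV Thm. 48 through `FSV2018_thm48_topFanIn`, plan
HOME/np/p1g3-THM48-provenance-and-plan.md §8.2, "TOP"), this file turns a member of the reduced class
`occurClassTopFanIn F ι D k s t` (F1, `FSV18OccurTopFanIn`) into the level-`2` family the levels
recursion starts from — an indexed family `G : Fin m → OccurFormula F ι`, `m ≤ t`, of sub-formulas with
the PER-GATE resource bounds occur `≤ k`, size `≤ s`, depth `≤ D - 1` and `f = Σ_u (G u).eval`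
(orders `T_u = 0`) — and records that the induction invariant of the recursion at the top level
(faithfulness to every such family, in Thm. 2.1 form) IS the generator property for the class.

* `OccurArgs.exists_fin_view_length` — the indexed-family view of a `+` gate's argument list with
  the index size pinned to F1's `OccurArgs.length` (on which the top-fan-in bound is stated).
* `exists_top_family_of_mem_occurClassTopFanIn` — the level-`2` family of a member of the class.
* `isHittingSetGenerator_occurClassTopFanIn_of_top` — invariant at the top ⇒ generator.

Theorem-only; no definitions, no named facts. Honest framing: bookkeeping for the N1 chain;
`VP ≠ VNP` is NOT proved and nothing here bears on it.

## References
* [AgrawalEtAl2011] arXiv:1111.0582 §4 (proof of Thm. dDkrPIT, top level; Thm. 2.1) — locator: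
  paper:arxiv-1111.0582 p0009.txt:L22–L34, p0007.txt:L19–L21.
* [ForbesShpilkaVolk2018] Def. 45 (seq.) = ToC Def. 5.21 (the model), Thm. 48 = ToC Thm. 5.24.
-/

noncomputable section

namespace Literature.Computability.AlgebraicComplexity

open MvPolynomial Finset Literature.Barriers.ValiantsHypothesis

open scoped BigOperators

open Literature.RepresentationTheory.AlgebraicGroups (iterPderiv iterPderiv_zero)

variable {F : Type*} [Field F] {ι : Type*}

/-- **A `+` gate is `H_1 + ⋯ + H_m` with `m` = its fan-in** (`OccurArgs.length`): the indexed-family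
view of FSV Def. 45's argument list with additive `occur`/`size` and `max` depth bookkeeping, index
size pinned to the fan-in ("`C(x) = Σ_{i=1}^{m} T_i`, where `T_i`'s are computed by … gates at the
next level"). [cite: ForbesShpilkaVolk2018, Def. 45 (seq.) = ToC Def. 5.21; AgrawalEtAl2011, §4 (¶1)]
locator: paper:arxiv-1701.05328 p0020.txt:L65; paper:arxiv-1111.0582 p0009.txt:L7–L9 -/
theorem OccurArgs.exists_fin_view_length : ∀ as : OccurArgs F ι,
    ∃ (m : ℕ) (φ : Fin m → OccurFormula F ι), m = as.length ∧
      as.evalSum = ∑ i, (φ i).eval ∧ (∀ j, as.occur j = ∑ i, (φ i).occur j) ∧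
        as.size = ∑ i, (φ i).size ∧ ∀ i, (φ i).depth ≤ as.depth
  | .nil => ⟨0, Fin.elim0, by rw [OccurArgs.length], by rw [OccurArgs.evalSum, Fintype.sum_empty],
      fun j => by rw [OccurArgs.occur, Fintype.sum_empty],
      by rw [OccurArgs.size, Fintype.sum_empty], fun i => i.elim0⟩
  | .cons ψ rest => by
    obtain ⟨m, φ, hm, hev, hocc, hsz, hdp⟩ := OccurArgs.exists_fin_view_length rest
    refine ⟨m + 1, Fin.cons ψ φ, by rw [OccurArgs.length, hm], ?_, fun j => ?_, ?_, fun i => ?_⟩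
    · rw [OccurArgs.evalSum, hev, Fin.sum_univ_succ, Fin.cons_zero]
      simp only [Fin.cons_succ]
    · rw [OccurArgs.occur, hocc, Fin.sum_univ_succ, Fin.cons_zero]
      simp only [Fin.cons_succ]
    · rw [OccurArgs.size, hsz, Fin.sum_univ_succ, Fin.cons_zero]
      simp only [Fin.cons_succ]
    · rw [OccurArgs.depth]
      refine Fin.cases ?_ (fun i => ?_) i
      · rw [Fin.cons_zero]; exact le_max_left _ _
      · rw [Fin.cons_succ]; exact (hdp i).trans (le_max_right _ _)

/-- **The level-`2` family of a top-fan-in-`≤ t` occur formula** ("Let `C(x) = Σ_{i=1}^{k} T_i` …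
the gates `T_i`'s are at level `2`"): a member `f` of `occurClassTopFanIn F ι D k s t` is
`Σ_{u < m} G_u` for `m ≤ t` sub-formulas `G_u`, each of an occur-`k` formula (occur `≤ k`), of size
`≤ s` and depth `≤ D - 1`; equivalently `f = C(U)` for `C = Σ_u X_u` and the order-`0` derivative family
`U_u = Δ_∅ G_u`. [cite: AgrawalEtAl2011, §4 (proof of Thm. dDkrPIT, ¶2)]
locator: paper:arxiv-1111.0582 p0009.txt:L22–L27 -/
theorem exists_top_family_of_mem_occurClassTopFanIn {D k s t : ℕ} {f : MvPolynomial ι F}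
    (hf : f ∈ occurClassTopFanIn F ι D k s t) :
    ∃ (m : ℕ) (G : Fin m → OccurFormula F ι), m ≤ t ∧ (∀ u i, (G u).occur i ≤ k) ∧
      (∀ u, (G u).size ≤ s) ∧ (∀ u, (G u).depth ≤ D - 1) ∧ f = ∑ u, (G u).eval ∧
      f = aeval (fun u => iterPderiv (A := F) 0 (G u).eval)
        (∑ u : Fin m, (X u : MvPolynomial (Fin m) F)) := by
  obtain ⟨as, hfe, hD, hk, hs, ht⟩ := hf
  obtain ⟨m, φ, hm, hev, hocc, hsz, hdp⟩ := OccurArgs.exists_fin_view_length as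
  have hsum : f = ∑ u, (φ u).eval := by rw [← hfe, OccurFormula.eval, hev]
  refine ⟨m, φ, by omega, fun u i => ?_, fun u => ?_, fun u => ?_, hsum, ?_⟩
  · have h := hk i
    rw [OccurFormula.occur, hocc] at h
    exact (Finset.single_le_sum (f := fun v => (φ v).occur i) (fun _ _ => Nat.zero_le _)
      (Finset.mem_univ u)).trans h
  · rw [OccurFormula.size, hsz] at hs
    exact (Finset.single_le_sum (f := fun v => (φ v).size) (fun _ _ => Nat.zero_le _)
      (Finset.mem_univ u)).trans (by omega)
  · rw [OccurFormula.depth] at hD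
    have := hdp u
    omega
  · rw [hsum, map_sum]
    refine Finset.sum_congr rfl fun u _ => ?_
    rw [aeval_X, iterPderiv_zero, LinearMap.id_apply]

/-- **The top of the recursion**: if a polynomial map `gen` (read as the substitution
`Ψ = aeval gen`) is faithful — in Thm. 2.1 form `C(U) ≠ 0 ↔ C(Ψ U) ≠ 0` — to every level-`2` family
of the class (at most `t` sub-formulas with occur `≤ k`, size `≤ s`, depth `≤ D - 1`, order-`0`
derivatives), then `gen` is a hitting-set generator for `occurClassTopFanIn F ι D k s t` ("The goal
is to construct a `Φ` that is faithful to `T` … it would follow that `Φ(D) = 0` iff `D = 0`").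
This is the induction invariant of the levels recursion at its top level turned into the conclusion
of `FSV2018_thm48_topFanIn`. [cite: AgrawalEtAl2011, §4 (proof of Thm. dDkrPIT, ¶2) with Thm. 2.1]
locator: paper:arxiv-1111.0582 p0009.txt:L24–L32; p0007.txt:L19–L21 -/
theorem isHittingSetGenerator_occurClassTopFanIn_of_top {σ : Type*} {M : Set (σ →₀ ℕ)}
    {D k s t : ℕ} {τ : Type*} (gen : M → MvPolynomial τ F)
    (h : ∀ (m : ℕ) (G : Fin m → OccurFormula F M) (T : Fin m → M →₀ ℕ), m ≤ t →
      (∀ u i, (G u).occur i ≤ k) → (∀ u, (G u).size ≤ s) → (∀ u, (G u).depth ≤ D - 1) →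
      (∀ u, (T u).degree ≤ 0) → ∀ C : MvPolynomial (Fin m) F,
        aeval (fun u => iterPderiv (A := F) (T u) (G u).eval) C ≠ 0 ↔
          aeval (fun u => aeval gen (iterPderiv (A := F) (T u) (G u).eval)) C ≠ 0) :
    IsHittingSetGenerator (occurClassTopFanIn F M D k s t) gen := by
  intro f hf hf0
  obtain ⟨m, G, hm, hk, hs, hd, hsum, haeval⟩ := exists_top_family_of_mem_occurClassTopFanIn hf
  have h1 := (h m G (fun _ => 0) hm hk hs hd (fun _ => by rw [map_zero]) (∑ u, X u)).mp
    (by rw [← haeval]; exact hf0)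
  have h2 : aeval (fun u => aeval gen (iterPderiv (A := F) ((fun _ => (0 : M →₀ ℕ)) u) (G u).eval))
      (∑ u : Fin m, (X u : MvPolynomial (Fin m) F)) = bind₁ gen f := by
    rw [map_sum, hsum, ← aeval_eq_bind₁, map_sum]
    refine Finset.sum_congr rfl fun u _ => ?_
    rw [aeval_X, iterPderiv_zero, LinearMap.id_apply]
  rw [h2] at h1
  exact h1

end Literature.Computability.AlgebraicComplexity
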